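import Literature.NumberTheory.EllipticCurves.MatarNekovar2019.IrreducibleOverQuadraticFieldProofs
import Literature.NumberTheory.GaloisRepresentations.CyclotomicDeterminantImageProofs
import Mathlib.FieldTheory.Finite.Basic
import Mathlib.FieldTheory.Galois.Infinite
import Mathlib.NumberTheory.NumberField.Cyclotomic.Basic
import HarnessLib

/-!
# Matar–Nekovář 2019, Proposition 5.26 (3) is a THEOREM: if `E_K[p]` is irreducible but not
# absolutely irreducible (`K` quadratic, `(N_E, d_K) = 1`, `p` odd), then `p = 3` and
# `K = ℚ(√−3)`

`Proofs`-style file (THEOREMS ONLY: no definition, no named fact, no instance), topic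
`NumberTheory/EllipticCurves`: the discharge
`prop526_three_of_irreducible_of_not_isAbsolutelyIrreducible_holds` of the named fact
`Literature.NumberTheory.EllipticCurves.MatarNekovar2019.prop526_three_of_irreducible_of_not_isAbsolutelyIrreducible`
(A. Matar, J. Nekovář, J. Théor. Nombres Bordeaux **31** (2019), Prop. 5.26 (3), p. 492, proof
p. 493 — held `paper:doi-10-5802-jtnb-1091`, materialised pages p0039 L51–53 and p0040 L35–55),
sibling of `IrreducibleOverQuadraticFieldProofs.lean` (clause (2)), whose exported machinery
(§0 Minkowski, §3 ramification away from `p`, §5 Serre's ordinary line, §6a `det = χ̄_p`) it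
reuses. The printed proof (p. 493):

> "(3). Firstly, `ρ(G_K)` is contained in `C_ns` but not in `C_ns ∩ C_s = 𝔽_pˣ · I`. Secondly,
> `ρ(G_ℚ)` contains `ρ(c̃) ∉ C_ns`, hence `ρ(G_ℚ) ≠ ρ(G_K)`; thus `D_K = p*` and `E` has good
> reduction at `p`. If the reduction at `p` is supersingular, then
> `#ρ(G_K) = #ρ(G_ℚ)/2 ≥ #ρ(G_{ℚ_p})/2 = #C_ns ≥ #ρ(G_K)`. It follows that `ρ(G_K) = C_ns` and
> `det ρ(G_K) = N_{𝔽_{p²}/𝔽_p}(𝔽_{p²}ˣ) = 𝔽_pˣ`, which is equivalent to `ℚ(μ_p) ∩ K = ℚ`, but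
> this is not true. If the reduction at `p` is ordinary, then the restriction of `ρ` to `I_p` is
> of the form `(χ_{p,ℚ_p} ∗; 0 1) ⊂ C_ns`, which implies again that `χ_{p,K_𝔭}|_{I_𝔭} = 1`,
> `p = 3`, `K = ℚ(√−3)` …"

## The argument as formalised (same architecture; `C_ns` replaced by "commutative image")

Write `H = Gal(ℚ̄/K) = res(Γ_K) ≤ Γ_ℚ` (open of index `2`) and `E[p] = E(ℚ̄)[p]`.
* §1 ("`ρ(G_K) ⊂ C_ns`", linear algebra) A set of matrices in `M₂(𝔽_p)` with a common
  eigenvector `v` over a field `B ⊇ 𝔽_p` but no common eigenvector over `𝔽_p` is COMMUTATIVE: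
  the Frobenius twin `v^(p)` is a second common eigenvector, independent of `v` (otherwise `v`
  is proportional to an `𝔽_p`-rational vector, `Subfield.mem_bot_iff_pow_eq_self`), so all the
  matrices are diagonal in the basis `(v, v^(p))`.
* §2 (transport) Hence for an irreducible, not absolutely irreducible framing of `E_K[p]`
  (`FramedRep.exists_eigenvector_of_not_isAbsolutelyIrreducible`) the elements of `H` act on
  `E[p]` pairwise commutingly (`exists_addEquiv_geomPoints_baseChange`), and no line of `E[p]`
  is `H`-stable ((irr_K)).
* §3 ("`ρ(c̃) ∉ C_ns`", "`ρ(G_ℚ) ≠ ρ(G_K)`") A complex conjugation `c` fixes exactly a line of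
  `E[p]` (`det ρ̄(c) = χ̄_p(c) = −1`, §6a of the sibling file); an element of `Γ_ℚ` acting
  trivially on `E[p]` lies in `H` (else `Γ_ℚ` acts through `ρ̄(H)`, commutative, and `Fix(c)`
  is an `H`-stable line).
* §4 (supersingular `p`, Serre Prop. 12) the square `s` of an inertia element `τ ∉ H` whose
  image generates the cyclic inertia image of order `p² − 1` commutes with `c` (as `cτ` or `c`,
  and `τ²`, lie in `H` and `ρ̄(H)` is commutative), so `s` stabilises the line `Fix(c)`: then
  `s^{p−1}` is unipotent and `p² − 1 ∣ 2p(p − 1)` — absurd (the arithmetic of the sibling's §4).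
* §5 (ordinary `p ≥ 5`, Serre Prop. 11) for `τ ∈ I_𝔓` acting on the ordinary line `ℤ v₀` by
  `2`, `τ² ∈ H` commutes with `H`, and its `4`-eigenline `ℤ v₀` (`4 ≢ 1`) is `H`-stable — (irr_K).
* §6 (ordinary `p = 3`) for `τ ∈ I_𝔓`: `τ ∈ H ⟺ χ̄₃(τ) = 1` (`⟸`: unipotent of order `3`,
  `τ = (τ²)⁻¹ · τ³` with `τ³ ∈ ker ρ̄ ≤ H`; `⟹`: else the `(−1)`-eigenline `ℤ v₀` of `τ` is
  `H`-stable); with `V = ker χ̄₃` the third index-`2` subgroup `{σ : σ ∈ H ↔ σ ∈ V}` would be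
  unramified everywhere, so `H = V` ("`K = ℚ(√−3)`").
* §7 (`H = ker χ̄₃ ⟹ d_K = −3`) `ζ₃ ∈ ℚ̄^H = e(K)` (`InfiniteGalois.fixedField_fixingSubgroup`),
  so `K = ℚ(ζ₃)` is `IsCyclotomicExtension {3} ℚ K` and `d_K = −3`
  (Mathlib `IsCyclotomicExtension.Rat.discr_prime`).
* §8 Assembly ("`D_K = p*`": `H` contains the inertia groups at every `q ≠ p` —
  Néron–Ogg–Shafarevich + §3 at good `q`, `(N_E, d_K) = 1` at bad `q` (sibling §3) —, so by
  Minkowski (sibling §0) `p ∤ N_E` and some inertia group above `p` is not inside `H`; then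
  §4–§7), the reduction to a global minimal model (as in the sibling's §6c; framings transport
  along a change of equation, `isTorsionGaloisRep_smul`) and the discharge.

Deviations from print: `C_ns` is never named — only the commutativity of `ρ̄(G_K)` and the
rationality of eigenlines are used; "`D_K = p*`" is replaced by "`H` is unramified outside `p`
and ramified at `p`" (Minkowski), and at `p = 3` by `H = ker χ̄₃`; the real quadratic case needs
no separate treatment. References: [MatarNekovar2019] Prop. 5.26 (3) (p. 492) and its proof
(p. 493); [Serre1972] §1.11 Prop. 11 and Cor., Prop. 12; §4.2 Lemme 2.
-/

set_option autoImplicit false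

noncomputable section

open scoped Classical NumberField Pointwise Matrix IntermediateField

open WeierstrassCurve Field IsDedekindDomain NumberField Rat.HeightOneSpectrum
  Literature.NumberTheory.EllipticCurves Literature.NumberTheory.GaloisRepresentations

universe u

namespace Literature.NumberTheory.EllipticCurves.MatarNekovar2019

/-! ### §1 Linear algebra: a common eigenvector over an extension and none over `𝔽_p` force
commutativity -/

section Matrices

variable {p : ℕ} [Fact p.Prime] {B : Type*} [Field B]

/-- In a field of characteristic `p`, the fixed points of `x ↦ x^p` are the image of `𝔽_p`
(Mathlib `Subfield.mem_bot_iff_pow_eq_self`). [folklore] -/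
private theorem exists_apply_eq_of_pow_eq_self (f : ZMod p →+* B) {t : B} (ht : t ^ p = t) :
    ∃ x : ZMod p, f x = t := by
  haveI : CharP B p := charP_of_injective_ringHom f.injective p
  have hmem : t ∈ (⊥ : Subfield B) := (Subfield.mem_bot_iff_pow_eq_self B p).mpr ht
  rw [← ZMod.fieldRange_castHom_eq_bot p, RingHom.mem_fieldRange] at hmem
  obtain ⟨x, hx⟩ := hmem
  exact ⟨x, by rw [Subsingleton.elim f (ZMod.castHom (dvd_refl p) B)]; exact hx⟩

/-- **A set of `2 × 2` matrices over `𝔽_p` with a common eigenvector over a field `B ⊇ 𝔽_p` but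
no common eigenvector over `𝔽_p` is commutative.** The Frobenius twin `v^(p)` of the common
eigenvector `v` is again a common eigenvector; if it were proportional to `v`, then `v` would be
proportional to an `𝔽_p`-rational common eigenvector; so `(v, v^(p))` is a basis of `B²` in
which every matrix of the set is diagonal. ("`ρ(G_K)` is contained in `C_ns`" in the printed
proof; Schur's lemma form.) [cite: MatarNekovar2019, proof of Prop. 5.26 (3) (p. 493)] -/
theorem mul_comm_of_common_eigenvector (f : ZMod p →+* B) (S : Set (Matrix (Fin 2) (Fin 2) (ZMod p)))
    {v : Fin 2 → B} (hv : v ≠ 0) (heig : ∀ M ∈ S, ∃ a : B, M.map f *ᵥ v = a • v)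
    (hirr : ∀ x : Fin 2 → ZMod p, x ≠ 0 → ∃ M ∈ S, ∀ a : ZMod p, M *ᵥ x ≠ a • x) :
    ∀ M ∈ S, ∀ N ∈ S, M * N = N * M := by
  have hp : p.Prime := Fact.out
  haveI : CharP B p := charP_of_injective_ringHom f.injective p
  have hfrob : ∀ x : ZMod p, f x ^ p = f x := fun x ↦ by rw [← map_pow, ZMod.pow_card]
  -- the Frobenius twin `w = v^(p)` is a common eigenvector
  set w : Fin 2 → B := fun i ↦ v i ^ p with hwdef
  have hmapfrob : ∀ M : Matrix (Fin 2) (Fin 2) (ZMod p),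
      (M.map f).map (frobenius B p) = M.map f := fun M ↦ by
    ext i j
    simp only [Matrix.map_apply, frobenius_def, hfrob]
  have heigw : ∀ M ∈ S, ∃ a : B, M.map f *ᵥ w = a • w := by
    intro M hM
    obtain ⟨a, ha⟩ := heig M hM
    refine ⟨a ^ p, funext fun i ↦ ?_⟩
    have h1 := RingHom.map_mulVec (frobenius B p) (M.map f) v i
    rw [hmapfrob, frobenius_def, ha] at h1
    have hw' : (⇑(frobenius B p) ∘ v) = w := funext fun j ↦ by
      simp only [Function.comp_apply, frobenius_def, hwdef]
    rw [hw'] at h1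
    rw [← h1, Pi.smul_apply, Pi.smul_apply, smul_eq_mul, smul_eq_mul, mul_pow]
  -- `w ∉ B v`
  have hindep : ∀ μ : B, w ≠ μ • v := by
    intro μ hμ
    obtain ⟨i, hi⟩ : ∃ i, v i ≠ 0 := by
      by_contra! h
      exact hv (funext h)
    have hμi : v i ^ p = μ * v i := by simpa [hwdef] using congrFun hμ i
    have hμ0 : μ ≠ 0 := by
      intro h0
      rw [h0, zero_mul] at hμi
      exact pow_ne_zero p hi hμi
    have ht : ∀ j, ((v i)⁻¹ * v j) ^ p = (v i)⁻¹ * v j := by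
      intro j
      have hμj : v j ^ p = μ * v j := by simpa [hwdef] using congrFun hμ j
      rw [mul_pow, inv_pow, hμj, hμi]
      field_simp
    choose x hx using fun j ↦ exists_apply_eq_of_pow_eq_self f (ht j)
    have hxi : x i = 1 := by
      apply f.injective
      rw [hx i, inv_mul_cancel₀ hi, map_one]
    have hx0 : x ≠ 0 := by
      intro h0
      have := congrFun h0 i
      rw [hxi, Pi.zero_apply] at this
      exact one_ne_zero this
    obtain ⟨M, hM, hMx⟩ := hirr x hx0
    obtain ⟨a, ha⟩ := heig M hM
    have hfx : (⇑f ∘ x) = (v i)⁻¹ • v := funext fun j ↦ by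
      rw [Function.comp_apply, hx j, Pi.smul_apply, smul_eq_mul]
    have hMfx : ∀ j, f ((M *ᵥ x) j) = a * f (x j) := by
      intro j
      rw [RingHom.map_mulVec f M x j, hfx, Matrix.mulVec_smul, ha, smul_smul, mul_comm _ a,
        ← smul_smul, ← hfx, Pi.smul_apply, smul_eq_mul, Function.comp_apply]
    set b : ZMod p := (M *ᵥ x) i with hbdef
    have hab : a = f b := by
      have := hMfx i
      rw [hxi, map_one, mul_one] at this
      exact this.symm
    apply hMx b
    funext j
    apply f.injective
    rw [hMfx j, hab, Pi.smul_apply, smul_eq_mul, map_mul]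
  -- hence every `M ∈ S` is diagonal in the basis `(v, w)`: commutators kill `v` and `w`
  intro M hM N hN
  obtain ⟨a, ha⟩ := heig M hM
  obtain ⟨b, hb⟩ := heig N hN
  obtain ⟨a', ha'⟩ := heigw M hM
  obtain ⟨b', hb'⟩ := heigw N hN
  set C : Matrix (Fin 2) (Fin 2) B := (M * N - N * M).map f with hCdef
  have hCv : C *ᵥ v = 0 := by
    rw [hCdef, Matrix.map_sub f (map_sub f), Matrix.map_mul, Matrix.map_mul, Matrix.sub_mulVec,
      ← Matrix.mulVec_mulVec, ← Matrix.mulVec_mulVec, hb, ha, Matrix.mulVec_smul,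
      Matrix.mulVec_smul, ha, hb, smul_smul, smul_smul, mul_comm b a, sub_self]
  have hCw : C *ᵥ w = 0 := by
    rw [hCdef, Matrix.map_sub f (map_sub f), Matrix.map_mul, Matrix.map_mul, Matrix.sub_mulVec,
      ← Matrix.mulVec_mulVec, ← Matrix.mulVec_mulVec, hb', ha', Matrix.mulVec_smul,
      Matrix.mulVec_smul, ha', hb', smul_smul, smul_smul, mul_comm b' a', sub_self]
  have hdet : v 0 * w 1 - w 0 * v 1 ≠ 0 := fun h ↦ by
    obtain ⟨c, hc⟩ := Serre1972.exists_eq_smul_of_det_eq_zero hv h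
    exact hindep c hc
  set Q : Matrix (Fin 2) (Fin 2) B := !![v 0, w 0; v 1, w 1] with hQdef
  have hQ : IsUnit Q.det := by
    rw [hQdef, Matrix.det_fin_two_of]
    exact isUnit_iff_ne_zero.mpr (by
      intro h
      apply hdet
      linear_combination h)
  have hCQ : C * Q = 0 := by
    rw [hQdef, Serre1972.mul_cols, hCv, hCw]
    ext i j
    fin_cases i <;> fin_cases j <;> rfl
  have hC0 : C = 0 := by
    rw [← Matrix.mul_nonsing_inv_cancel_right Q C hQ, hCQ, zero_mul]
  have hMN : (M * N - N * M).map f = (0 : Matrix (Fin 2) (Fin 2) (ZMod p)).map f := by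
    rw [← hCdef, hC0, Matrix.map_zero f (map_zero f)]
  exact sub_eq_zero.mp (Matrix.map_injective f.injective hMN)

end Matrices

/-! ### §2 Framings of `E_K[p]`: irreducible + not absolutely irreducible ⇒ commutative image;
transport to `E(ℚ̄)[p]` along `res : Γ_K → Γ_ℚ` -/

section Framed

variable {F : Type u} [Field F] {p : ℕ} [Fact p.Prime]

/-- **`E[p]` irreducible ⇒ every framing of `E[p]` is irreducible** (any base field `F`): a
subrepresentation of `𝔽_p²` pulls back along the frame `e : E[p] ≃ 𝔽_p²` to a `Γ_F`-stable
subgroup of `E[p]`. (The sibling statement `Automorphic.BCDT.isIrreducible_of_hasIrreducibleModPGaloisRep`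
is the case `F = ℚ`; same proof.) [cite: SilvermanCSS1997, §7] -/
theorem isIrreducible_of_hasIrreducibleModPGaloisRep_field {W : WeierstrassCurve F}
    (hirr : W.HasIrreducibleModPGaloisRep p) {ρ : ModPGaloisRep F (ZMod p) 2}
    (hρ : W.IsTorsionGaloisRep p ρ) : FramedRep.IsIrreducible ρ := by
  obtain ⟨e, he⟩ := hρ
  have hbt : (⊥ : Subrepresentation (FramedRep.toRepresentation ρ)) ≠ ⊤ := by
    intro h
    have h' : (⊥ : Submodule (ZMod p) (Fin 2 → ZMod p)) = ⊤ :=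
      congrArg Subrepresentation.toSubmodule h
    exact bot_ne_top h'
  refine { toNontrivial := ⟨⟨⊥, ⊤, hbt⟩⟩, eq_bot_or_eq_top := fun V ↦ ?_ }
  let H : AddSubgroup (geomTorsion W p) := V.toSubmodule.toAddSubgroup.comap e.toAddMonoidHom
  have hHmem : ∀ Q : geomTorsion W p, Q ∈ H ↔ e Q ∈ V.toSubmodule := fun Q ↦ Iff.rfl
  have hH : ∀ σ : Field.absoluteGaloisGroup F, ∀ Q ∈ H, σ • Q ∈ H := by
    intro σ Q hQ
    rw [hHmem] at hQ ⊢
    rw [he σ Q]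
    exact V.apply_mem_toSubmodule σ hQ
  rcases hirr H hH with hH0 | hH1
  · left
    apply Subrepresentation.toSubmodule_injective
    change V.toSubmodule = ⊥
    refine (Submodule.eq_bot_iff _).mpr fun x hx ↦ ?_
    have hx' : e.symm x ∈ H := by rw [hHmem, e.apply_symm_apply]; exact hx
    rw [hH0, AddSubgroup.mem_bot] at hx'
    rw [← e.apply_symm_apply x, hx', map_zero]
  · right
    apply Subrepresentation.toSubmodule_injective
    change V.toSubmodule = ⊤
    refine Submodule.eq_top_iff'.mpr fun x ↦ ?_
    have hx' : e.symm x ∈ H := by rw [hH1]; exact AddSubgroup.mem_top _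
    rw [hHmem, e.apply_symm_apply] at hx'
    exact hx'

/-- **An irreducible framing of `E[p]` that is not absolutely irreducible has commutative
image**: `ρ̄(γ₁) ρ̄(γ₂) = ρ̄(γ₂) ρ̄(γ₁)` (§1 applied to the image of `ρ̄`, with the common
eigenvector of `FramedRep.exists_eigenvector_of_not_isAbsolutelyIrreducible` and the absence of
`𝔽_p`-rational ones, `FramedRep.exists_mulVec_ne_smul_of_isIrreducible`).
[cite: MatarNekovar2019, proof of Prop. 5.26 (3) (p. 493), "`ρ(G_K)` is contained in `C_ns`"] -/
theorem map_mul_comm_of_not_isAbsolutelyIrreducible (ρ : ModPGaloisRep F (ZMod p) 2)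
    (hirr : FramedRep.IsIrreducible ρ) (habs : ¬ FramedRep.IsAbsolutelyIrreducible ρ)
    (γ₁ γ₂ : absoluteGaloisGroup F) : ρ γ₁ * ρ γ₂ = ρ γ₂ * ρ γ₁ := by
  obtain ⟨B, _, f, v, hv, hB⟩ := FramedRep.exists_eigenvector_of_not_isAbsolutelyIrreducible ρ habs
  set S : Set (Matrix (Fin 2) (Fin 2) (ZMod p)) :=
    Set.range fun γ ↦ ((ρ γ : GL (Fin 2) (ZMod p)) : Matrix (Fin 2) (Fin 2) (ZMod p)) with hS
  have heig : ∀ M ∈ S, ∃ a : B, M.map f *ᵥ v = a • v := by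
    rintro M ⟨γ, rfl⟩
    exact hB γ
  have hirr' : ∀ x : Fin 2 → ZMod p, x ≠ 0 → ∃ M ∈ S, ∀ a : ZMod p, M *ᵥ x ≠ a • x := by
    intro x hx
    obtain ⟨γ, hγ⟩ := FramedRep.exists_mulVec_ne_smul_of_isIrreducible ρ hirr hx
    exact ⟨_, ⟨γ, rfl⟩, hγ⟩
  have h := mul_comm_of_common_eigenvector f S hv heig hirr' _ ⟨γ₁, rfl⟩ _ ⟨γ₂, rfl⟩
  exact Units.ext (by rw [Units.val_mul, Units.val_mul]; exact h)

/-- **The elements of `Γ_F` act on `E[p]` pairwise commutingly** when `E[p]` is irreducible and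
some framing of it is not absolutely irreducible. [cite: MatarNekovar2019, proof of Prop. 5.26 (3) (p. 493)] -/
theorem smul_comm_of_not_isAbsolutelyIrreducible {W : WeierstrassCurve F}
    (hirr : W.HasIrreducibleModPGaloisRep p) {ρ : ModPGaloisRep F (ZMod p) 2}
    (hρ : W.IsTorsionGaloisRep p ρ) (habs : ¬ FramedRep.IsAbsolutelyIrreducible ρ)
    (γ₁ γ₂ : absoluteGaloisGroup F) (Q : geomTorsion W p) : γ₁ • γ₂ • Q = γ₂ • γ₁ • Q := by
  have hcomm := map_mul_comm_of_not_isAbsolutelyIrreducible ρ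
    (isIrreducible_of_hasIrreducibleModPGaloisRep_field hirr hρ) habs γ₁ γ₂
  obtain ⟨e, he⟩ := hρ
  apply e.injective
  rw [he, he, he, he, Matrix.mulVec_mulVec, Matrix.mulVec_mulVec, ← Units.val_mul, ← Units.val_mul,
    hcomm]

end Framed


section Transport

variable (W : WeierstrassCurve ℚ) [W.IsElliptic] (K : Type) [Field K] [NumberField K]
  (p : ℕ) [Fact p.Prime]

omit [W.IsElliptic] [Fact p.Prime] in
/-- **`E[p] = E(ℚ̄)[p] ≃ E_K(K̄)[p]` equivariantly along `res : Γ_K → Γ_ℚ`** (restriction of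
`exists_addEquiv_geomPoints_baseChange` to the `p`-torsion): the Galois module `E[p]` of `E/ℚ`
restricted to `G_{K̄/K}` is the Galois module `E_K[p]` (Silverman, *AEC* III.§7 and VIII.§1).
[cite: SilvermanAEC2009, III.§7 (the `G_{K̄/K}`-module `E[m]`) and VIII.§1] -/
theorem exists_addEquiv_geomTorsion_baseChange :
    ∃ eT : geomTorsion W (p : ℤ) ≃+ geomTorsion (W.baseChange K) (p : ℤ),
      ∀ (γ : absoluteGaloisGroup K) (P : geomTorsion W (p : ℤ)),
        eT (absGaloisRestrict ℚ K γ • P) = γ • eT P := by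
  obtain ⟨e, he⟩ := W.exists_addEquiv_geomPoints_baseChange K
  have htor : ∀ {P : geomPoints W},
      P ∈ geomTorsion W (p : ℤ) ↔ e P ∈ geomTorsion (W.baseChange K) (p : ℤ) := by
    intro P
    rw [geomTorsion, geomTorsion, AddSubgroup.torsionBy.nsmul_iff,
      AddSubgroup.torsionBy.nsmul_iff, ← map_nsmul, AddEquiv.map_eq_zero_iff]
  let eT : geomTorsion W (p : ℤ) ≃+ geomTorsion (W.baseChange K) (p : ℤ) :=
    { toFun := fun P ↦ ⟨e P, htor.mp P.2⟩
      invFun := fun Q ↦ ⟨e.symm Q, by rw [htor, e.apply_symm_apply]; exact Q.2⟩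
      left_inv := fun P ↦ Subtype.ext (e.symm_apply_apply _)
      right_inv := fun Q ↦ Subtype.ext (e.apply_symm_apply _)
      map_add' := fun P Q ↦ Subtype.ext (by
        change e ((P : geomPoints W) + Q) = e P + e Q
        exact map_add e _ _) }
  refine ⟨eT, fun γ P ↦ Subtype.ext ?_⟩
  change e (((absGaloisRestrict ℚ K γ • P : geomTorsion W (p : ℤ)) : geomPoints W)) = _
  rw [AddSubgroup.torsionBy.coe_smul, he]
  rfl

omit [W.IsElliptic] in
/-- **`H = res(Γ_K)` acts on `E[p]` through pairwise commuting automorphisms** when `E_K[p]` is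
irreducible and some framing of it is not absolutely irreducible ("`ρ(G_K) ⊂ C_ns`").
[cite: MatarNekovar2019, proof of Prop. 5.26 (3) (p. 493)] -/
theorem smul_comm_of_mem_range (hirrK : (W.baseChange K).HasIrreducibleModPGaloisRep p)
    {ρ : ModPGaloisRep K (ZMod p) 2} (hρ : (W.baseChange K).IsTorsionGaloisRep p ρ)
    (habs : ¬ FramedRep.IsAbsolutelyIrreducible ρ)
    {σ₁ : absoluteGaloisGroup ℚ} (hσ₁ : σ₁ ∈ (absGaloisRestrict ℚ K).range)
    {σ₂ : absoluteGaloisGroup ℚ} (hσ₂ : σ₂ ∈ (absGaloisRestrict ℚ K).range)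
    (P : geomTorsion W (p : ℤ)) : σ₁ • σ₂ • P = σ₂ • σ₁ • P := by
  obtain ⟨γ₁, rfl⟩ := hσ₁
  obtain ⟨γ₂, rfl⟩ := hσ₂
  obtain ⟨eT, heT⟩ := exists_addEquiv_geomTorsion_baseChange W K p
  apply eT.injective
  change eT (absGaloisRestrict ℚ K γ₁ • absGaloisRestrict ℚ K γ₂ • P) =
    eT (absGaloisRestrict ℚ K γ₂ • absGaloisRestrict ℚ K γ₁ • P)
  rw [heT, heT, heT, heT]
  exact smul_comm_of_not_isAbsolutelyIrreducible hirrK hρ habs γ₁ γ₂ (eT P)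

omit [W.IsElliptic] [Fact p.Prime] in
/-- **No `H`-stable line** (transport of (irr_K)): a subgroup `Φ ≠ 0, E[p]` of `E[p]` stable
under `H = res(Γ_K)` would give a `Γ_K`-stable subgroup `≠ 0, E_K[p]` of `E_K[p]`.
[cite: MatarNekovar2019, proof of Prop. 5.26 (3) (p. 493), "not in `C_ns ∩ C_s`"] -/
theorem false_of_stable_of_hasIrreducibleModPGaloisRep_baseChange
    (hirrK : (W.baseChange K).HasIrreducibleModPGaloisRep p)
    {Φ : AddSubgroup (geomTorsion W (p : ℤ))} (hbot : Φ ≠ ⊥) (htop : Φ ≠ ⊤)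
    (hstab : ∀ σ ∈ (absGaloisRestrict ℚ K).range, ∀ P ∈ Φ, σ • P ∈ Φ) : False := by
  obtain ⟨eT, heT⟩ := exists_addEquiv_geomTorsion_baseChange W K p
  set Φ' : AddSubgroup (geomTorsion (W.baseChange K) (p : ℤ)) := Φ.map eT.toAddMonoidHom
    with hΦ'def
  have hmemΦ' : ∀ Q, Q ∈ Φ' ↔ eT.symm Q ∈ Φ := by
    intro Q
    rw [hΦ'def, AddSubgroup.mem_map]
    constructor
    · rintro ⟨P, hP, rfl⟩
      change eT.symm (eT P) ∈ Φ
      rwa [eT.symm_apply_apply]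
    · intro hQ
      exact ⟨eT.symm Q, hQ, eT.apply_symm_apply Q⟩
  have hstab' : ∀ γ : absoluteGaloisGroup K, ∀ Q ∈ Φ', γ • Q ∈ Φ' := by
    intro γ Q hQ
    rw [hmemΦ'] at hQ ⊢
    have h1 : γ • Q = eT (absGaloisRestrict ℚ K γ • eT.symm Q) := by
      rw [heT, eT.apply_symm_apply]
    rw [h1, eT.symm_apply_apply]
    exact hstab _ ⟨γ, rfl⟩ _ hQ
  rcases hirrK Φ' hstab' with h | h
  · apply hbot
    rw [eq_bot_iff]
    intro P hP
    have hP' : eT P ∈ Φ' := by rw [hmemΦ', eT.symm_apply_apply]; exact hP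
    rw [h, AddSubgroup.mem_bot, EmbeddingLike.map_eq_zero_iff] at hP'
    rw [hP']
    exact AddSubgroup.mem_bot.mpr rfl
  · apply htop
    rw [eq_top_iff]
    intro P _
    have hP' : eT P ∈ Φ' := by rw [h]; exact AddSubgroup.mem_top _
    rw [hmemΦ', eT.symm_apply_apply] at hP'
    exact hP'

end Transport

/-! ### §3 Complex conjugation fixes exactly a line of `E[p]`; the kernel of `ρ̄` lies in `H` -/

section Conj

variable (W : WeierstrassCurve ℚ) [W.IsElliptic] (p : ℕ) [Fact p.Prime]

omit [W.IsElliptic] [Fact p.Prime] in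
/-- `p E[p] = 0`. [folklore] -/
private theorem natCast_zsmul_eq_zero (P : geomTorsion W (p : ℤ)) : ((p : ℕ) : ℤ) • P = 0 := by
  rw [← Subtype.coe_inj, AddSubgroupClass.coe_zsmul, ZeroMemClass.coe_zero]
  exact (Submodule.mem_torsionBy_iff _ _).mp P.2

/-- A subgroup `Φ ≠ 0, E[p]` of `E[p]` has order `p` (`#E[p] = p²`). [folklore] -/
private theorem card_eq_of_ne_bot_of_ne_top {Φ : AddSubgroup (geomTorsion W (p : ℤ))} (hbot : Φ ≠ ⊥)
    (htop : Φ ≠ ⊤) : Nat.card Φ = p := by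
  have hp : p.Prime := Fact.out
  have hcard := Rank1Residual.natCard_geomTorsion W p
  haveI : Finite (geomTorsion W (p : ℤ)) :=
    Nat.finite_of_card_ne_zero (by rw [hcard]; exact pow_ne_zero 2 hp.ne_zero)
  have hdvd : Nat.card Φ ∣ p ^ 2 := hcard ▸ Φ.card_addSubgroup_dvd_card
  obtain ⟨i, hi, hHi⟩ := (Nat.dvd_prime_pow hp).mp hdvd
  interval_cases i
  · exact absurd (AddSubgroup.card_eq_one.mp (by simpa using hHi)) hbot
  · simpa using hHi
  · exact absurd ((AddSubgroup.card_eq_iff_eq_top Φ).mp (by rw [hHi, hcard])) htop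

/-- **A basis of `E[p]`**: some `P₀ ≠ 0` and `P₁ ∉ ℤ P₀`. [folklore] -/
private theorem exists_basis : ∃ P₀ P₁ : geomTorsion W (p : ℤ), P₀ ≠ 0 ∧ P₁ ∉ AddSubgroup.zmultiples P₀ := by
  have hp : p.Prime := Fact.out
  have hE := Rank1Residual.natCard_geomTorsion W p
  haveI : Finite (geomTorsion W (p : ℤ)) :=
    Nat.finite_of_card_ne_zero (by rw [hE]; exact pow_ne_zero 2 hp.ne_zero)
  have hnt : 1 < Nat.card (geomTorsion W (p : ℤ)) := by
    rw [hE]; exact Nat.one_lt_pow two_ne_zero hp.one_lt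
  haveI : Nontrivial (geomTorsion W (p : ℤ)) := Finite.one_lt_card_iff_nontrivial.mp hnt
  obtain ⟨P₀, hP₀⟩ := exists_ne (0 : geomTorsion W (p : ℤ))
  have hord : addOrderOf P₀ = p :=
    addOrderOf_eq_prime (by rw [← natCast_zsmul, natCast_zsmul_eq_zero]) hP₀
  have hX : AddSubgroup.zmultiples P₀ ≠ ⊤ := by
    intro h
    have h1 := Nat.card_zmultiples P₀
    rw [h, AddSubgroup.card_top, hE, hord] at h1
    have h2 : p * p = p * 1 := by rw [mul_one, ← pow_two]; exact h1
    exact hp.one_lt.ne' (Nat.eq_of_mul_eq_mul_left hp.pos h2)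
  obtain ⟨P₁, hP₁⟩ : ∃ P₁ : geomTorsion W (p : ℤ), P₁ ∉ AddSubgroup.zmultiples P₀ := by
    by_contra! h
    exact hX (eq_top_iff.mpr fun x _ ↦ h x)
  exact ⟨P₀, P₁, hP₀, hP₁⟩

/-- **Complex conjugation fixes exactly a line of `E[p]` (`p ≠ 2`)**: for a complex conjugation
`c ∈ Γ_ℚ` (`c² = 1`, `χ̄_p(c) = −1`), the fixed subgroup `Fix(c) ≤ E[p]` has order `p` — it is
neither `0` (then `c = −1` on `E[p]`, of determinant `1 ≠ −1`) nor `E[p]` (determinant `1`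
again), by `det ρ̄ = χ̄_p` (`modPCyclotomicCharacter_eq_det_of_basis`). ("`ρ(G_ℚ)` contains
`ρ(c̃) ∉ C_ns`" — `ρ̄(c̃)` has the rational eigenvalues `±1`.)
[cite: MatarNekovar2019, proof of Prop. 5.26 (3) (p. 493)] [cite: Serre1972, §1.11 (`det = χ̄_p`)] -/
theorem exists_complexConjugation_fixedLine (hp2 : p ≠ 2) :
    ∃ c : absoluteGaloisGroup ℚ, c * c = 1 ∧
      ∃ L : AddSubgroup (geomTorsion W (p : ℤ)), Nat.card L = p ∧ ∀ P, P ∈ L ↔ c • P = P := by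
  have hp : p.Prime := Fact.out
  haveI : NeZero ((p : ℕ) : ℚ) := ⟨by exact_mod_cast hp.ne_zero⟩
  obtain ⟨c, hc⟩ := exists_isComplexConjugation (Rat.castHom ℝ)
  have hcc : c * c = 1 := by rw [← pow_two]; exact hc.sq_eq_one
  have hχ : ((modPCyclotomicCharacterZMod ℚ p c : (ZMod p)ˣ) : ZMod p) = -1 := by
    rw [modPCyclotomicCharacterZMod_eq_modNCyclotomicCharacter]
    simpa using modNCyclotomicCharacter_of_isComplexConjugation (N := p) hc
  let L : AddSubgroup (geomTorsion W (p : ℤ)) :=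
    { carrier := {P | c • P = P}
      add_mem' := fun {a b} ha hb ↦ by
        simp only [Set.mem_setOf_eq] at ha hb ⊢
        rw [smul_add, ha, hb]
      zero_mem' := by
        simp only [Set.mem_setOf_eq]
        exact smul_zero c
      neg_mem' := fun {a} ha ↦ by
        simp only [Set.mem_setOf_eq] at ha ⊢
        rw [smul_neg, ha] }
  have hmemL : ∀ P, P ∈ L ↔ c • P = P := fun P ↦ Iff.rfl
  refine ⟨c, hcc, L, ?_, hmemL⟩
  obtain ⟨P₀, P₁, hP₀, hP₁⟩ := exists_basis W p
  have h2 : (1 : ZMod p) ≠ -1 := by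
    intro h
    have h' : ((2 : ℕ) : ZMod p) = 0 := by
      rw [Nat.cast_two]
      linear_combination h
    rw [ZMod.natCast_eq_zero_iff] at h'
    exact hp2 ((Nat.prime_dvd_prime_iff_eq hp Nat.prime_two).mp h')
  have hbot : L ≠ ⊥ := by
    intro hL
    have hneg : ∀ P : geomTorsion W (p : ℤ), c • P = -P := by
      intro P
      have hmem : P + c • P ∈ L := by
        rw [hmemL, smul_add, ← mul_smul, hcc, one_smul, add_comm]
      rw [hL, AddSubgroup.mem_bot] at hmem
      exact eq_neg_of_add_eq_zero_right hmem
    have h₀ : c • P₀ = (-1 : ℤ) • P₀ + (0 : ℤ) • P₁ := by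
      rw [hneg, neg_one_zsmul, zero_smul, add_zero]
    have h₁ : c • P₁ = (0 : ℤ) • P₀ + (-1 : ℤ) • P₁ := by
      rw [hneg, neg_one_zsmul, zero_smul, zero_add]
    have hdet := modPCyclotomicCharacter_eq_det_of_basis W p hP₀ hP₁ h₀ h₁
    rw [hχ] at hdet
    apply h2
    rw [hdet]
    push_cast
    ring
  have htop : L ≠ ⊤ := by
    intro hL
    have hfix : ∀ P : geomTorsion W (p : ℤ), c • P = P := fun P ↦
      (hmemL P).mp (hL ▸ AddSubgroup.mem_top P)
    have h₀ : c • P₀ = (1 : ℤ) • P₀ + (0 : ℤ) • P₁ := by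
      rw [hfix, one_smul, zero_smul, add_zero]
    have h₁ : c • P₁ = (0 : ℤ) • P₀ + (1 : ℤ) • P₁ := by
      rw [hfix, one_smul, zero_smul, zero_add]
    have hdet := modPCyclotomicCharacter_eq_det_of_basis W p hP₀ hP₁ h₀ h₁
    rw [hχ] at hdet
    apply h2
    rw [hdet]
    push_cast
    ring
  exact card_eq_of_ne_bot_of_ne_top W p hbot htop

variable {W p} {H : Subgroup (absoluteGaloisGroup ℚ)} (hH2 : H.index = 2)
  (hcomm : ∀ σ₁ ∈ H, ∀ σ₂ ∈ H, ∀ P : geomTorsion W (p : ℤ), σ₁ • σ₂ • P = σ₂ • σ₁ • P)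
  (hnoline : ∀ Φ : AddSubgroup (geomTorsion W (p : ℤ)), Nat.card Φ = p →
    (∀ σ ∈ H, ∀ P ∈ Φ, σ • P ∈ Φ) → False)
include hH2 hcomm hnoline

/-- **`ker ρ̄ ≤ H`** ("`ρ(G_ℚ) ≠ ρ(G_K)`" in the printed proof): if `σ₀` acts trivially on `E[p]`
but `σ₀ ∉ H`, then every element of `Γ_ℚ = H ∪ H σ₀` acts like an element of `H`, so the action
of `Γ_ℚ` is commutative and the fixed line of a complex conjugation is `H`-stable — contradicting
(irr_K). [cite: MatarNekovar2019, proof of Prop. 5.26 (3) (p. 493)] -/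
theorem mem_of_forall_smul_eq (hp2 : p ≠ 2) {σ₀ : absoluteGaloisGroup ℚ}
    (hσ₀ : ∀ P : geomTorsion W (p : ℤ), σ₀ • P = P) : σ₀ ∈ H := by
  by_contra hσ₀H
  obtain ⟨c, -, L, hL, hmemL⟩ := exists_complexConjugation_fixedLine W p hp2
  have hact : ∀ g : absoluteGaloisGroup ℚ, ∃ h ∈ H, ∀ P : geomTorsion W (p : ℤ),
      g • P = h • P := by
    intro g
    by_cases hg : g ∈ H
    · exact ⟨g, hg, fun P ↦ rfl⟩
    · refine ⟨g * σ₀⁻¹, ?_, fun P ↦ ?_⟩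
      · rw [Subgroup.mul_mem_iff_of_index_two hH2]
        exact iff_of_false hg (by rwa [Subgroup.inv_mem_iff])
      · rw [mul_smul]
        congr 1
        rw [eq_comm, inv_smul_eq_iff, hσ₀]
  obtain ⟨c', hc'H, hc'⟩ := hact c
  refine hnoline L hL fun h hh P hP ↦ ?_
  rw [hmemL] at hP ⊢
  rw [hc', hcomm c' hc'H h hh, ← hc', hP]

end Conj

/-! ### §4 Serre's Proposition 12: a good supersingular `p` is impossible -/

section Supersingular

variable {W : WeierstrassCurve ℚ} [W.IsElliptic] [W.IsGloballyMinimal] {p : ℕ} [Fact p.Prime]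
  {H : Subgroup (absoluteGaloisGroup ℚ)} (hH2 : H.index = 2)
  (hcomm : ∀ σ₁ ∈ H, ∀ σ₂ ∈ H, ∀ P : geomTorsion W (p : ℤ), σ₁ • σ₂ • P = σ₂ • σ₁ • P)
include hH2 hcomm

/-- **Supersingular `p` is impossible** (Serre 1972 §1.11 Prop. 12; "if the reduction at `p` is
supersingular … `ρ(G_K) = C_ns` … but this is not true" in the printed proof). At an odd prime
`p` of good supersingular reduction the inertia image at `𝔓 ∣ p` is cyclic of order `p² − 1`
(`isCyclic_and_card_inertia_map_of_dvd_frobeniusTrace`); if `I_𝔓 ⊄ H`, pick `τ ∈ I_𝔓 ∖ H` whose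
image generates it. For a complex conjugation `c`: `cτ` or `c` lies in `H`, as does `τ²`, and
`ρ̄(H)` is commutative, so `c` commutes with `s = τ²` on `E[p]` and `s` stabilises the line
`Fix(c)`; then `s` acts on `Fix(c)` and on `E[p]/Fix(c)` by scalars, `s^{p−1}` is unipotent and
`τ^{2p(p−1)} = 1` on `E[p]`: `p² − 1 ∣ 2p(p − 1)` — absurd.
[cite: Serre1972, §1.11 Prop. 12] [cite: MatarNekovar2019, proof of Prop. 5.26 (3) (p. 493)] -/
theorem false_of_supersingular_of_not_le (hp2 : p ≠ 2) (hgood : W.HasGoodReductionAtPrime p)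
    (hss : (p : ℤ) ∣ W.frobeniusTrace p) {v : HeightOneSpectrum (𝓞 ℚ)}
    (hv : (primesEquiv v : ℕ) = p) {𝔓' : Ideal (absIntegers (𝓞 ℚ) ℚ)} (h𝔓' : 𝔓' ∈ v.primesAbove)
    (hI' : ¬ 𝔓'.inertia (absoluteGaloisGroup ℚ) ≤ H) : False := by
  have hp : p.Prime := Fact.out
  haveI hHn : H.Normal := Subgroup.normal_of_index_eq_two hH2
  have hΔ : ¬ (p : ℤ) ∣ minimalDiscriminantInt W :=
    W.not_dvd_minimalDiscriminantInt_of_hasGoodReductionAtPrime' p hgood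
  have hE := Rank1Residual.natCard_geomTorsion W p
  haveI : Finite (geomTorsion W (p : ℤ)) :=
    Nat.finite_of_card_ne_zero (by rw [hE]; exact pow_ne_zero 2 hp.ne_zero)
  -- the place's prime `𝔓` (conjugate to `𝔓'`; `H` is normal, so `I_𝔓 ⊄ H` as well)
  obtain ⟨𝔓, hmem, h𝔓⟩ := exists_ideal_placeOver p hv
  have hI : ¬ 𝔓.inertia (absoluteGaloisGroup ℚ) ≤ H := by
    intro hle
    obtain ⟨s, hs⟩ :=
      IsDedekindDomain.HeightOneSpectrum.exists_smul_eq_of_mem_primesAbove_holds (K := ℚ) (v := v)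
        h𝔓 h𝔓'
    obtain ⟨τ, hτ, hτH⟩ := SetLike.not_le_iff_exists.mp hI'
    have hτ' : s⁻¹ * τ * s ∈ 𝔓.inertia (absoluteGaloisGroup ℚ) := by
      apply Literature.NumberTheory.GaloisRepresentations.DegreeOnePrimes.conj_mem_inertia_of_mem_inertia_smul
      rw [hs]
      exact hτ
    have h1 := hHn.conj_mem _ (hle hτ') s
    rw [show s * (s⁻¹ * τ * s) * s⁻¹ = τ by group] at h1
    exact hτH h1
  -- the cyclic inertia image of order `p² − 1` and a generator
  have hT : ∀ π ζ : AlgebraicClosure ℚ, π ^ (p ^ 2 - 1) = p → ζ ^ (p ^ 2 - 1) = 1 →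
      ∃ s ∈ 𝔓.inertia (absoluteGaloisGroup ℚ), s • π = ζ * π := fun π ζ hπ hζ ↦
    exists_mem_inertia_smul_eq_mul_of_pow_eq p
      (Nat.sub_pos_of_lt (Nat.one_lt_pow two_ne_zero hp.one_lt)) hv h𝔓 hπ hζ
  obtain ⟨hcyc, hcard⟩ := isCyclic_and_card_inertia_map_of_dvd_frobeniusTrace p hΔ hss hp2 hmem hT
  set G := (𝔓.inertia (absoluteGaloisGroup ℚ)).map (galoisRepTorsion W (p : ℤ)) with hGdef
  haveI := hcyc
  obtain ⟨gen, hgen⟩ := IsCyclic.exists_generator (α := G)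
  have hordgen : orderOf gen = p ^ 2 - 1 := by
    rw [orderOf_eq_card_of_forall_mem_zpowers hgen, hcard]
  obtain ⟨τ₁, hτ₁I, hτ₁g⟩ := Subgroup.mem_map.mp gen.2
  -- an inertia element OUTSIDE `H` whose image generates
  obtain ⟨τ, hτI, hτH, hordτ⟩ : ∃ τ ∈ 𝔓.inertia (absoluteGaloisGroup ℚ), τ ∉ H ∧
      orderOf (galoisRepTorsion W (p : ℤ) τ) = p ^ 2 - 1 := by
    have hordτ₁ : orderOf (galoisRepTorsion W (p : ℤ) τ₁) = p ^ 2 - 1 := by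
      rw [hτ₁g, Subgroup.orderOf_coe, hordgen]
    by_cases hτ₁H : τ₁ ∈ H
    · obtain ⟨τ₀, hτ₀I, hτ₀H⟩ := SetLike.not_le_iff_exists.mp hI
      have hmem : (⟨galoisRepTorsion W (p : ℤ) τ₀, Subgroup.mem_map_of_mem _ hτ₀I⟩ : G) ∈
          Subgroup.zpowers gen := hgen _
      obtain ⟨k, hk⟩ := Subgroup.mem_zpowers_iff.mp hmem
      refine ⟨τ₀ * τ₁ ^ (1 - k), Subgroup.mul_mem _ hτ₀I (Subgroup.zpow_mem _ hτ₁I _), ?_, ?_⟩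
      · rwa [Subgroup.mul_mem_cancel_right H (Subgroup.zpow_mem H hτ₁H (1 - k))]
      · have himg : galoisRepTorsion W (p : ℤ) (τ₀ * τ₁ ^ (1 - k)) = (gen : _) := by
          have hk' : ((gen ^ k : G) : Multiplicative (AddAut (geomTorsion W (p : ℤ)))) =
              galoisRepTorsion W (p : ℤ) τ₀ := congrArg Subtype.val hk
          rw [map_mul, map_zpow, hτ₁g, ← hk', ← Subgroup.coe_zpow, ← Subgroup.coe_mul,
            ← zpow_add, add_sub_cancel, zpow_one]
        rw [himg, Subgroup.orderOf_coe, hordgen]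
    · exact ⟨τ₁, hτ₁I, hτ₁H, hordτ₁⟩
  -- `σ = τ²` stabilises the fixed line of a complex conjugation
  set σ : absoluteGaloisGroup ℚ := τ * τ with hσdef
  have hσH : σ ∈ H := Subgroup.mul_self_mem_of_index_two hH2 τ
  obtain ⟨c, -, Φ₀, hΦ₀, hmemΦ₀⟩ := exists_complexConjugation_fixedLine W p hp2
  haveI : Finite Φ₀ := Nat.finite_of_card_ne_zero (by rw [hΦ₀]; exact hp.ne_zero)
  have hcσ : ∀ P : geomTorsion W (p : ℤ), c • σ • P = σ • c • P := by
    intro P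
    by_cases hcH : c ∈ H
    · exact hcomm c hcH σ hσH P
    · have hcτ : c * τ ∈ H := by
        rw [Subgroup.mul_mem_iff_of_index_two hH2]
        exact iff_of_false hcH hτH
      have key := hcomm (c * τ) hcτ σ hσH (τ⁻¹ • P)
      simp only [hσdef, mul_smul, smul_inv_smul] at key
      simp only [hσdef, mul_smul]
      exact key
  have hstab : ∀ P ∈ Φ₀, σ • P ∈ Φ₀ := by
    intro P hP
    rw [hmemΦ₀] at hP ⊢
    rw [hcσ, hP]
  -- the arithmetic of Serre's Prop. 12 (as in the sibling file's §4)
  obtain ⟨k, hk⟩ := exists_smul_eq_zsmul_of_stable hΦ₀ hstab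
  obtain ⟨d, hd⟩ := exists_smul_sub_zsmul_mem_of_stable hΦ₀ hE hstab
  have hnt : 1 < Nat.card Φ₀ := by rw [hΦ₀]; exact hp.one_lt
  haveI : Nontrivial Φ₀ := Finite.one_lt_card_iff_nontrivial.mp hnt
  obtain ⟨⟨P₀, hP₀⟩, hP₀0⟩ := exists_ne (0 : Φ₀)
  have hP₀0' : P₀ ≠ 0 := fun h ↦ hP₀0 (Subtype.ext h)
  have hptor := natCast_zsmul_eq_zero W p
  have hkp : ¬ (p : ℤ) ∣ k := by
    rintro ⟨c, rfl⟩
    have h := hk P₀ hP₀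
    rw [mul_zsmul, hptor] at h
    exact hP₀0' ((smul_eq_zero_iff_eq σ).mp h)
  have hdp : ¬ (p : ℤ) ∣ d := by
    rintro ⟨c, rfl⟩
    have hall : ∀ P : geomTorsion W (p : ℤ), σ • P ∈ Φ₀ := fun P ↦ by
      have h := hd P
      rwa [mul_zsmul, hptor, sub_zero] at h
    have htop : Φ₀ = ⊤ := by
      refine eq_top_iff.mpr fun P _ ↦ ?_
      have := hall (σ⁻¹ • P)
      rwa [smul_inv_smul] at this
    exact ne_top_of_card_eq hΦ₀ htop
  have hpi : Prime (p : ℤ) := Nat.prime_iff_prime_int.mp hp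
  have hfermat : ∀ m : ℤ, ¬ (p : ℤ) ∣ m → ∀ P : geomTorsion W (p : ℤ), (m ^ (p - 1)) • P = P := by
    intro m hm P
    have h1 : m ^ (p - 1) ≡ 1 [ZMOD p] :=
      Int.ModEq.pow_card_sub_one_eq_one hp ((hpi.coprime_iff_not_dvd.mpr hm).symm)
    obtain ⟨c, hc⟩ := (Int.modEq_iff_dvd.mp h1.symm)
    have h2' : m ^ (p - 1) = 1 + (p : ℤ) * c := by linarith
    rw [h2', add_smul, one_smul, mul_zsmul, hptor, add_zero]
  have hfix : ∀ P ∈ Φ₀, (σ ^ (p - 1)) • P = P := fun P hP ↦ by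
    rw [pow_smul_eq_pow_zsmul hk (p - 1) P hP, hfermat k hkp P]
  have hquot : ∀ P : geomTorsion W (p : ℤ), (σ ^ (p - 1)) • P - P ∈ Φ₀ := fun P ↦ by
    have h := pow_smul_sub_pow_zsmul_mem hstab hd (p - 1) P
    rwa [hfermat d hdp P] at h
  have htriv : ∀ P : geomTorsion W (p : ℤ), (σ ^ ((p - 1) * p)) • P = P := fun P ↦ by
    rw [pow_mul]; exact pow_prime_smul_eq_self_of_unipotent hfix hquot P
  have hone : galoisRepTorsion W (p : ℤ) (σ ^ ((p - 1) * p)) = 1 :=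
    (galoisRepTorsion_eq_one_iff' W (p : ℤ) _).mpr htriv
  rw [hσdef, ← pow_two, ← pow_mul, map_pow] at hone
  have hdvd : p ^ 2 - 1 ∣ 2 * ((p - 1) * p) := hordτ ▸ orderOf_dvd_of_pow_eq_one hone
  -- `p² − 1 ∣ 2p(p − 1)` is absurd for a prime `p`
  obtain ⟨q, hq⟩ := hdvd
  have h1p : 1 ≤ p := hp.one_lt.le
  have h1p2 : 1 ≤ p ^ 2 := Nat.one_le_pow 2 p hp.pos
  have hqZ : (2 : ℤ) * (((p : ℤ) - 1) * p) = ((p : ℤ) ^ 2 - 1) * q := by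
    have h := congrArg (Nat.cast : ℕ → ℤ) hq
    push_cast [Nat.cast_sub h1p, Nat.cast_sub h1p2] at h
    exact h
  have hp2Z : (2 : ℤ) ≤ p := by exact_mod_cast hp.two_le
  have hsq : (0 : ℤ) ≤ (p : ℤ) ^ 2 - 1 := by nlinarith
  rcases Nat.lt_or_ge q 2 with hq2 | hq2
  · interval_cases q
    · simp only [Nat.cast_zero, mul_zero] at hqZ
      nlinarith
    · simp only [Nat.cast_one, mul_one] at hqZ
      nlinarith
  · have hq2Z : (2 : ℤ) ≤ q := by exact_mod_cast hq2
    nlinarith [mul_nonneg (sub_nonneg.mpr hq2Z) hsq]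

end Supersingular

/-! ### §5 Serre's Proposition 11: a good ordinary `p ≥ 5` is impossible -/

section Ordinary

variable {W : WeierstrassCurve ℚ} [W.IsElliptic] {p : ℕ} [Fact p.Prime]
  {H : Subgroup (absoluteGaloisGroup ℚ)}
  (hcomm : ∀ σ₁ ∈ H, ∀ σ₂ ∈ H, ∀ P : geomTorsion W (p : ℤ), σ₁ • σ₂ • P = σ₂ • σ₁ • P)
  (hnoline : ∀ Φ : AddSubgroup (geomTorsion W (p : ℤ)), Nat.card Φ = p →
    (∀ σ ∈ H, ∀ P ∈ Φ, σ • P ∈ Φ) → False)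
include hcomm hnoline

omit [W.IsElliptic] in
/-- **A rational eigenline of an element of `H` is `H`-stable** (the common core of §5 and §6):
if `σ ∈ H` acts on `v₀ ≠ 0` by a scalar `a ≢ 1 (mod p)` and `σ x − x ∈ ℤ v₀` for all `x`
(so `ℤ v₀ = ker(σ − a)`), then every `h ∈ H` — which commutes with `σ` — maps `v₀` into
`ker(σ − a) = ℤ v₀`; so the line `ℤ v₀` is `H`-stable, contradicting (irr_K). ("the restriction
of `ρ` to `I_p` … `⊂ C_ns`, which implies … `χ_{p,K_𝔭}|_{I_𝔭} = 1`" in the printed proof.)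
[cite: MatarNekovar2019, proof of Prop. 5.26 (3) (p. 493)] -/
theorem false_of_mem_of_smul_eq_zsmul {v₀ : geomTorsion W (p : ℤ)} (hv₀ : v₀ ≠ 0)
    {σ : absoluteGaloisGroup ℚ} (hσH : σ ∈ H) {a : ℤ} (hσv₀ : σ • v₀ = a • v₀)
    (ha : ¬ (p : ℤ) ∣ a - 1)
    (hline : ∀ x : geomTorsion W (p : ℤ), ∃ n : ℤ, σ • x - x = n • v₀) : False := by
  have hp : p.Prime := Fact.out
  have hpi : Prime (p : ℤ) := Nat.prime_iff_prime_int.mp hp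
  have hsmulz : ∀ (g : absoluteGaloisGroup ℚ) (n : ℤ) (x : geomTorsion W (p : ℤ)),
      g • (n • x) = n • (g • x) := fun g n x ↦ map_zsmul (DistribSMul.toAddMonoidHom _ g) n x
  set X : AddSubgroup (geomTorsion W (p : ℤ)) := AddSubgroup.zmultiples v₀ with hXdef
  have hordv₀ : addOrderOf v₀ = p :=
    addOrderOf_eq_prime (by rw [← natCast_zsmul, natCast_zsmul_eq_zero]) hv₀
  have hX : Nat.card X = p := by rw [hXdef, Nat.card_zmultiples, hordv₀]
  refine hnoline X hX fun h hh P hP ↦ ?_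
  obtain ⟨m, rfl⟩ := AddSubgroup.mem_zmultiples_iff.mp hP
  suffices hv : h • v₀ ∈ X by
    rw [hsmulz]
    exact X.zsmul_mem hv m
  set x : geomTorsion W (p : ℤ) := h • v₀ with hxdef
  have hσx : σ • x = a • x := by
    rw [hxdef, hcomm σ hσH h hh, hσv₀, hsmulz]
  obtain ⟨n, hn⟩ := hline x
  have h1 : (a - 1) • x = n • v₀ := by
    rw [sub_smul, one_smul, hσx.symm]
    exact hn
  obtain ⟨b, c, hbc⟩ := (hpi.coprime_iff_not_dvd.mpr ha).symm
  have hx : x = (b * n) • v₀ := by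
    calc x = (b * (a - 1) + c * (p : ℤ)) • x := by rw [hbc, one_smul]
      _ = b • ((a - 1) • x) + c • (((p : ℕ) : ℤ) • x) := by rw [add_smul, mul_smul, mul_smul]
      _ = (b * n) • v₀ := by rw [h1, natCast_zsmul_eq_zero, smul_zero, add_zero, smul_smul]
  rw [hx]
  exact X.zsmul_mem (AddSubgroup.mem_zmultiples v₀) _

variable [W.IsGloballyMinimal] (hH2 : H.index = 2)
include hH2

/-- **Good ordinary `p ≥ 5` is impossible** (Serre 1972 §1.11 Prop. 11 with Cor.; "the
restriction of `ρ` to `I_p` is of the form `(χ_{p,ℚ_p} ∗; 0 1) ⊂ C_ns`, which implies …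
`p = 3`" in the printed proof): with `v₀` the ordinary line at `𝔓 ∣ p` and `τ ∈ I_𝔓` acting on
`v₀` by `2` (`exists_ordinaryLine`), `σ = τ² ∈ H` acts on `v₀` by `4 ≢ 1 (mod p)` and
`σ x − x ∈ ℤ v₀`; by `false_of_mem_of_smul_eq_zsmul` the line `ℤ v₀` is `H`-stable.
[cite: Serre1972, §1.11 Prop. 11 and Cor.] [cite: MatarNekovar2019, proof of Prop. 5.26 (3) (p. 493)] -/
theorem false_of_ordinary_of_five_le (hp5 : 5 ≤ p) (hgood : W.HasGoodReductionAtPrime p)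
    (hord : ¬ (p : ℤ) ∣ W.frobeniusTrace p) {v : HeightOneSpectrum (𝓞 ℚ)}
    (hv : (primesEquiv v : ℕ) = p) {𝔓 : Ideal (absIntegers (𝓞 ℚ) ℚ)} (h𝔓 : 𝔓 ∈ v.primesAbove) :
    False := by
  have hsmulz : ∀ (g : absoluteGaloisGroup ℚ) (n : ℤ) (x : geomTorsion W (p : ℤ)),
      g • (n • x) = n • (g • x) := fun g n x ↦ map_zsmul (DistribSMul.toAddMonoidHom _ g) n x
  obtain ⟨v₀, hv₀, hline, hchar⟩ := exists_ordinaryLine hgood hord hv h𝔓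
  have h2p : ¬ (p : ℤ) ∣ 2 := fun h ↦ by
    have := Int.le_of_dvd two_pos h
    omega
  obtain ⟨τ, hτ, hτ2⟩ := hchar 2 h2p
  set σ : absoluteGaloisGroup ℚ := τ * τ with hσdef
  have hσH : σ ∈ H := Subgroup.mul_self_mem_of_index_two hH2 τ
  have hσI : σ ∈ 𝔓.inertia (absoluteGaloisGroup ℚ) := Subgroup.mul_mem _ hτ hτ
  have hσv₀ : σ • v₀ = (4 : ℤ) • v₀ := by
    rw [hσdef, mul_smul, hτ2, hsmulz, hτ2, smul_smul]
    norm_num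
  have h3 : ¬ (p : ℤ) ∣ 4 - 1 := fun h ↦ by
    have := Int.le_of_dvd (by norm_num) h
    omega
  exact false_of_mem_of_smul_eq_zsmul hcomm hnoline hv₀ hσH hσv₀ h3 (hline σ hσI)

end Ordinary

/-! ### §6 `p = 3`, good ordinary: `H = ker χ̄₃` ("`K = ℚ(√−3)`") -/

section Three

/-- Propositional bookkeeping for `exists_index_two_of_not_iff'`. [folklore] -/
private theorem xor_iff_iff_of_not_iff' {p q r s : Prop} (h : ¬ (r ↔ s)) :
    Xor ((p ↔ r) ↔ (q ↔ s)) (p ↔ q) := by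
  by_cases hr : r <;> by_cases hs : s
  · exact absurd (iff_of_true hr hs) h
  · by_cases hp : p <;> by_cases hq : q <;> simp [Xor, hp, hq, hr, hs]
  · by_cases hp : p <;> by_cases hq : q <;> simp [Xor, hp, hq, hr, hs]
  · exact absurd (iff_of_false hr hs) h

/-- **The third quadratic field**: for two distinct open subgroups `H, V` of index `2` in `Γ_ℚ`,
`{σ : σ ∈ H ↔ σ ∈ V}` is a third open subgroup of index `2`. (Same statement and proof as the
sibling file's private lemma.) [folklore] -/
private theorem exists_index_two_of_not_iff' {H V : Subgroup (absoluteGaloisGroup ℚ)}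
    (hH2 : H.index = 2) (hV2 : V.index = 2) (hH : IsOpen (H : Set (absoluteGaloisGroup ℚ)))
    (hV : IsOpen (V : Set (absoluteGaloisGroup ℚ))) {σ₁ : absoluteGaloisGroup ℚ}
    (hσ₁ : ¬ (σ₁ ∈ H ↔ σ₁ ∈ V)) :
    ∃ U : Subgroup (absoluteGaloisGroup ℚ), U.index = 2 ∧ IsOpen (U : Set (absoluteGaloisGroup ℚ)) ∧
      ∀ σ, σ ∈ U ↔ (σ ∈ H ↔ σ ∈ V) := by
  let U : Subgroup (absoluteGaloisGroup ℚ) :=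
    { carrier := {σ | σ ∈ H ↔ σ ∈ V}
      mul_mem' := by
        intro a b ha hb
        simp only [Set.mem_setOf_eq] at ha hb ⊢
        rw [Subgroup.mul_mem_iff_of_index_two hH2, Subgroup.mul_mem_iff_of_index_two hV2]
        tauto
      one_mem' := by
        simp only [Set.mem_setOf_eq]
        exact ⟨fun _ ↦ V.one_mem, fun _ ↦ H.one_mem⟩
      inv_mem' := by
        intro a ha
        simp only [Set.mem_setOf_eq] at ha ⊢
        rw [Subgroup.inv_mem_iff, Subgroup.inv_mem_iff]
        exact ha }
  have hmemU : ∀ σ, σ ∈ U ↔ (σ ∈ H ↔ σ ∈ V) := fun σ ↦ Iff.rfl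
  refine ⟨U, ?_, ?_, hmemU⟩
  · rw [Subgroup.index_eq_two_iff]
    refine ⟨σ₁, fun b ↦ ?_⟩
    rw [hmemU, hmemU, Subgroup.mul_mem_iff_of_index_two hH2,
      Subgroup.mul_mem_iff_of_index_two hV2]
    exact xor_iff_iff_of_not_iff' hσ₁
  · refine Subgroup.isOpen_mono (H₁ := H ⊓ V) (fun σ hσ ↦ ?_) ?_
    · rw [hmemU]
      exact ⟨fun _ ↦ (Subgroup.mem_inf.mp hσ).2, fun _ ↦ (Subgroup.mem_inf.mp hσ).1⟩
    · rw [Subgroup.coe_inf]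
      exact hH.inter hV

variable {W : WeierstrassCurve ℚ} [W.IsElliptic] [W.IsGloballyMinimal]
  {H : Subgroup (absoluteGaloisGroup ℚ)} (hH2 : H.index = 2)
  (hcomm : ∀ σ₁ ∈ H, ∀ σ₂ ∈ H, ∀ P : geomTorsion W ((3 : ℕ) : ℤ), σ₁ • σ₂ • P = σ₂ • σ₁ • P)
  (hnoline : ∀ Φ : AddSubgroup (geomTorsion W ((3 : ℕ) : ℤ)), Nat.card Φ = 3 →
    (∀ σ ∈ H, ∀ P ∈ Φ, σ • P ∈ Φ) → False)
  (hker : ∀ σ₀ : absoluteGaloisGroup ℚ, (∀ P : geomTorsion W ((3 : ℕ) : ℤ), σ₀ • P = P) → σ₀ ∈ H)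
include hH2 hcomm hnoline hker

/-- **At a prime above a good ordinary `3`: `τ ∈ I_𝔓` lies in `H` iff `χ̄₃(τ) = 1`.** In the
basis `(v₀, w)` of Serre's Prop. 11, `τ` acts by `(χ̄₃(τ) ∗; 0 1)` (`det ρ̄ = χ̄₃`,
`modPCyclotomicCharacter_eq_det_of_basis`). If `χ̄₃(τ) = 1`, `τ` is unipotent, `τ³ = 1` on `E[3]`,
so `τ³ ∈ H` (§3) and `τ = τ³ (τ²)⁻¹ ∈ H`. If `χ̄₃(τ) = −1` and `τ ∈ H`, the `(−1)`-eigenline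
`ℤ v₀` of `τ` is `H`-stable (`false_of_mem_of_smul_eq_zsmul`) — (irr_K).
[cite: Serre1972, §1.11 Prop. 11 and Cor.] [cite: MatarNekovar2019, proof of Prop. 5.26 (3) (p. 493)] -/
theorem mem_iff_modPCyclotomicCharacter_eq_one [NeZero ((3 : ℕ) : ℚ)]
    (hgood : W.HasGoodReductionAtPrime 3) (hord : ¬ ((3 : ℕ) : ℤ) ∣ W.frobeniusTrace 3)
    {v : HeightOneSpectrum (𝓞 ℚ)} (hv : (primesEquiv v : ℕ) = 3)
    {𝔓 : Ideal (absIntegers (𝓞 ℚ) ℚ)} (h𝔓 : 𝔓 ∈ v.primesAbove) {τ : absoluteGaloisGroup ℚ}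
    (hτ : τ ∈ 𝔓.inertia (absoluteGaloisGroup ℚ)) :
    τ ∈ H ↔ modPCyclotomicCharacterZMod ℚ 3 τ = 1 := by
  have hptor := natCast_zsmul_eq_zero W 3
  have hsmulz : ∀ (σ : absoluteGaloisGroup ℚ) (n : ℤ) (x : geomTorsion W ((3 : ℕ) : ℤ)),
      σ • (n • x) = n • (σ • x) := fun σ n x ↦ map_zsmul (DistribSMul.toAddMonoidHom _ σ) n x
  obtain ⟨v₀, hv₀, hline, -⟩ := exists_ordinaryLine (W := W) hgood hord hv h𝔓
  -- a second basis vector `w ∉ ℤ v₀`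
  have hX : AddSubgroup.zmultiples v₀ ≠ ⊤ := by
    have hordv₀ : addOrderOf v₀ = 3 := addOrderOf_eq_prime (by rw [← natCast_zsmul, hptor]) hv₀
    exact ne_top_of_card_eq (W := W) (p := 3) (by rw [Nat.card_zmultiples, hordv₀])
  obtain ⟨w, hw⟩ : ∃ w : geomTorsion W ((3 : ℕ) : ℤ), w ∉ AddSubgroup.zmultiples v₀ := by
    by_contra! h
    exact hX (eq_top_iff.mpr fun x _ ↦ h x)
  obtain ⟨n₀, hn₀⟩ := hline τ hτ v₀
  obtain ⟨n₁, hn₁⟩ := hline τ hτ w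
  have hτv₀ : τ • v₀ = (n₀ + 1) • v₀ + (0 : ℤ) • w := by
    rw [zero_smul, add_zero, add_smul, one_smul, ← hn₀, sub_add_cancel]
  have hτw : τ • w = n₁ • v₀ + (1 : ℤ) • w := by
    rw [one_smul, ← hn₁, sub_add_cancel]
  have hdetτ := modPCyclotomicCharacter_eq_det_of_basis W 3 hv₀ hw hτv₀ hτw
  constructor
  · intro hτH
    by_contra hχ
    have ha : ¬ ((3 : ℕ) : ℤ) ∣ (n₀ + 1) - 1 := by
      intro h3
      apply hχ
      apply Units.ext
      rw [hdetτ, Units.val_one]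
      have h0 : ((n₀ : ℤ) : ZMod 3) = 0 :=
        (ZMod.intCast_zmod_eq_zero_iff_dvd n₀ 3).mpr (by simpa using h3)
      push_cast
      rw [h0]
      ring
    have hτv₀' : τ • v₀ = (n₀ + 1) • v₀ := by rw [hτv₀, zero_smul, add_zero]
    exact false_of_mem_of_smul_eq_zsmul hcomm hnoline hv₀ hτH hτv₀' ha (hline τ hτ)
  · intro hχτ
    rw [hχτ, Units.val_one] at hdetτ
    have h3 : ((3 : ℕ) : ℤ) ∣ n₀ := by
      refine (ZMod.intCast_zmod_eq_zero_iff_dvd n₀ 3).mp ?_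
      have h1 : (1 : ZMod 3) = (n₀ : ZMod 3) + 1 := hdetτ.trans (by push_cast; ring)
      linear_combination -h1
    have hτv₀' : τ • v₀ = v₀ := by
      obtain ⟨c, hc⟩ := h3
      rw [hτv₀, zero_smul, add_zero, add_smul, one_smul, hc, mul_zsmul, hptor, zero_add]
    have hτnv : ∀ m : ℤ, τ • (m • v₀) = m • v₀ := fun m ↦ by rw [hsmulz, hτv₀']
    have hτ3 : ∀ x : geomTorsion W ((3 : ℕ) : ℤ), (τ * τ * τ) • x = x := by
      intro x
      obtain ⟨n, hn⟩ := hline τ hτ x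
      have hτx : τ • x = x + n • v₀ := by rw [← hn, add_sub_cancel]
      have h3v : n • v₀ + n • v₀ + n • v₀ = 0 := by
        rw [← add_zsmul, ← add_zsmul, show n + n + n = ((3 : ℕ) : ℤ) * n by push_cast; ring,
          mul_zsmul, hptor]
      simp only [mul_smul, hτx, smul_add, hτnv]
      rw [add_assoc, add_assoc, ← add_assoc (n • v₀), h3v, add_zero]
    have hτ3H : τ * τ * τ ∈ H := hker _ hτ3
    exact (Subgroup.mul_mem_cancel_left H (Subgroup.mul_self_mem_of_index_two hH2 τ)).mp hτ3H

/-- **`H = ker χ̄₃`** ("`K = ℚ(√−3)`"; `p = 3` good ordinary). Put `V = ker χ̄₃` (open, index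
`2`). Both `H` (hypothesis `haway`) and `V` (`χ̄₃` is unramified away from `3`) contain the
inertia groups at every `q ≠ 3`, and on the inertia groups above `3` membership in `H` and in
`V` agree (`mem_iff_modPCyclotomicCharacter_eq_one`). If `H ≠ V`, the third open index-`2`
subgroup `{σ : σ ∈ H ↔ σ ∈ V}` would contain every inertia group: an everywhere unramified
quadratic field (sibling §0, `not_forall_inertia_le_of_index_two`).
[cite: MatarNekovar2019, proof of Prop. 5.26 (3) (p. 493)] [cite: Serre1972, §1.11 Prop. 11 and Cor.] -/
theorem mem_iff_modPCyclotomicCharacter_eq_one_of_ordinary_three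
    (hopen : IsOpen (H : Set (absoluteGaloisGroup ℚ)))
    (hgood : W.HasGoodReductionAtPrime 3) (hord : ¬ ((3 : ℕ) : ℤ) ∣ W.frobeniusTrace 3)
    (haway : ∀ (𝔔 : Ideal (absIntegers (𝓞 ℚ) ℚ)) (v : HeightOneSpectrum (𝓞 ℚ)),
      𝔔 ∈ v.primesAbove → (primesEquiv v : ℕ) ≠ 3 → 𝔔.inertia (absoluteGaloisGroup ℚ) ≤ H)
    (σ : absoluteGaloisGroup ℚ) : σ ∈ H ↔ modPCyclotomicCharacterZMod ℚ 3 σ = 1 := by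
  haveI : NeZero ((3 : ℕ) : ℚ) := ⟨by norm_num⟩
  -- `V = ker χ̄₃`: open, of index two
  set V : Subgroup (absoluteGaloisGroup ℚ) := (modPCyclotomicCharacterZMod ℚ 3).ker with hVdef
  have hmemV : ∀ σ, σ ∈ V ↔ modPCyclotomicCharacterZMod ℚ 3 σ = 1 := fun σ ↦ MonoidHom.mem_ker
  have hV2 : V.index = 2 := by
    rw [hVdef, Subgroup.index_ker, MonoidHom.range_eq_top.mpr (fun u ↦
      modPCyclotomicCharacterZMod_rat_surjective 3 u), Subgroup.card_top, Nat.card_eq_fintype_card,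
      ZMod.card_units]
  have hVopen : IsOpen (V : Set (absoluteGaloisGroup ℚ)) := by
    obtain ⟨e, Φ, he, -, hdet, -, -⟩ := W.exists_frame_galoisRepTorsion_rat 3
    refine Subgroup.isOpen_mono (H₁ := (galoisRepTorsion W ((3 : ℕ) : ℤ)).ker) (fun σ hσ ↦ ?_)
      (isOpen_ker_galoisRepTorsion_holds W (n := ((3 : ℕ) : ℤ)) (by norm_num))
    rw [hmemV, ← hdet σ, MonoidHom.mem_ker.mp hσ, map_one, map_one]
  -- inertia away from `3` lies in `V` too (`χ̄₃` is unramified away from `3`)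
  have hawayV : ∀ (𝔔 : Ideal (absIntegers (𝓞 ℚ) ℚ)) (v : HeightOneSpectrum (𝓞 ℚ)),
      𝔔 ∈ v.primesAbove → (primesEquiv v : ℕ) ≠ 3 → 𝔔.inertia (absoluteGaloisGroup ℚ) ≤ V := by
    intro 𝔔 v h𝔔 hv3 τ hτ
    haveI := h𝔔.1
    rw [hmemV, modPCyclotomicCharacterZMod_eq_modNCyclotomicCharacter]
    refine modNCyclotomicCharacter_eq_one_of_mem_inertia ?_ hτ
    -- `3 ∉ 𝔔`
    intro hmem
    apply hv3
    have h1 : ((3 : ℕ) : 𝓞 ℚ) ∈ v.asIdeal := by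
      rw [h𝔔.2.over, Ideal.mem_comap, map_natCast]
      exact hmem
    have h2 : (primesEquiv v : ℕ) ∣ 3 := by
      rw [show ((primesEquiv v : Nat.Primes) : ℕ) = natGenerator v from rfl, natGenerator_dvd_iff,
        ← map_natCast (Rat.IsIntegralClosure.intEquiv (𝓞 ℚ)) 3, Ideal.apply_mem_of_equiv_iff]
      exact h1
    exact (Nat.prime_dvd_prime_iff_eq (primesEquiv v).2 Nat.prime_three).mp h2
  rw [← hmemV]
  -- suppose `H ≠ V`
  by_contra hσ
  -- the place at `3`
  set v₃ : HeightOneSpectrum (𝓞 ℚ) := primesEquiv.symm ⟨3, Nat.prime_three⟩ with hv₃def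
  have hv₃ : (primesEquiv v₃ : ℕ) = 3 := by rw [hv₃def, Equiv.apply_symm_apply]
  have heqv₃ : ∀ {v : HeightOneSpectrum (𝓞 ℚ)}, (primesEquiv v : ℕ) = 3 → v = v₃ := fun hv ↦
    primesEquiv.injective (Subtype.ext (hv.trans hv₃.symm))
  have hat3 : ∀ 𝔓 ∈ v₃.primesAbove, ∀ τ ∈ 𝔓.inertia (absoluteGaloisGroup ℚ),
      (τ ∈ H ↔ τ ∈ V) := fun 𝔓 h𝔓 τ hτ ↦ by
    rw [hmemV]
    exact mem_iff_modPCyclotomicCharacter_eq_one hH2 hcomm hnoline hker hgood hord hv₃ h𝔓 hτ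
  -- the third index-two subgroup `{σ : σ ∈ H ↔ σ ∈ V}` is unramified everywhere
  obtain ⟨U', hU'2, hU'open, hmemU'⟩ := exists_index_two_of_not_iff' hH2 hV2 hopen hVopen hσ
  refine not_forall_inertia_le_of_index_two U' hU'open hU'2 fun 𝔓 h𝔓max ↦ ?_
  obtain ⟨v, h𝔓⟩ := exists_mem_primesAbove_of_isMaximal 𝔓
  intro τ hτ
  rw [hmemU']
  by_cases hv : (primesEquiv v : ℕ) = 3
  · rw [heqv₃ hv] at h𝔓
    exact hat3 𝔓 h𝔓 τ hτ
  · exact ⟨fun _ ↦ hawayV 𝔓 v h𝔓 hv hτ, fun _ ↦ haway 𝔓 v h𝔓 hv hτ⟩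

end Three

/-! ### §7 `res(Γ_K) = ker χ̄₃ ⟹ K = ℚ(ζ₃) ⟹ d_K = −3` -/

section Cyclotomic

variable (K : Type) [Field K] [NumberField K]

/-- **If `Gal(ℚ̄/K) = ker χ̄₃` inside `Γ_ℚ`, then `d_K = −3`.** A primitive cube root of unity
`ζ ∈ ℚ̄` is fixed by `ker χ̄₃ = res(Γ_K) = Gal(ℚ̄/e(K))`, so `ζ ∈ e(K)` by the Galois
correspondence for `ℚ̄/ℚ` (`InfiniteGalois.fixedField_fixingSubgroup`); thus `K ∋ z` with
`z` a primitive cube root of unity, `ℚ(z) ⊆ K` has degree `φ(3) = 2 = [K : ℚ]`, so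
`K = ℚ(z)` is the third cyclotomic field and `d_K = (−1)^{(3−1)/2} · 3^{3−2} = −3`
(Mathlib `IsCyclotomicExtension.Rat.discr_prime`). ("`K = ℚ(√−3)`" in the printed proof.)
[cite: MatarNekovar2019, Prop. 5.26 (3) (p. 492)] -/
theorem discr_eq_neg_three_of_forall_mem_range_iff (h2 : Module.finrank ℚ K = 2)
    (hHV : ∀ σ : absoluteGaloisGroup ℚ,
      σ ∈ (absGaloisRestrict ℚ K).range ↔ modPCyclotomicCharacterZMod ℚ 3 σ = 1) :
    NumberField.discr K = -3 := by
  haveI : NeZero ((3 : ℕ) : ℚ) := ⟨by norm_num⟩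
  haveI : Algebra.IsAlgebraic ℚ (AlgebraicClosure ℚ) := AlgebraicClosure.isAlgebraic ℚ
  haveI : Normal ℚ (AlgebraicClosure ℚ) :=
    @IsAlgClosure.normal ℚ (AlgebraicClosure ℚ) _ _ (AlgebraicClosure.instAlgebra ℚ) inferInstance
  haveI : IsGalois ℚ (AlgebraicClosure ℚ) :=
    @IsAlgClosure.isGalois ℚ (AlgebraicClosure ℚ) _ _ (AlgebraicClosure.instAlgebra ℚ) inferInstance
      inferInstance
  -- a primitive cube root of unity `ζ ∈ ℚ̄`, fixed by `res(Γ_K)`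
  obtain ⟨ζ, hζ⟩ := HasEnoughRootsOfUnity.exists_primitiveRoot (AlgebraicClosure ℚ) 3
  have hfix : ∀ σ ∈ (absGaloisRestrict ℚ K).range, σ • ζ = ζ := by
    intro σ hσ
    rw [modPCyclotomicCharacterZMod_spec ℚ 3 σ ζ hζ.pow_eq_one, (hHV σ).mp hσ, Units.val_one,
      ZMod.val_one, pow_one]
  -- `ζ ∈ e(K)` by the Galois correspondence
  set F := (absEmbedding ℚ K).fieldRange with hFdef
  have hζF : ζ ∈ F := by
    rw [← InfiniteGalois.fixedField_fixingSubgroup F, IntermediateField.mem_fixedField_iff]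
    intro σ hσ
    have hσ' : (absoluteGaloisGroup.toAlgEquiv ℚ).symm σ ∈ (absGaloisRestrict ℚ K).range := by
      refine (mem_range_absGaloisRestrict_iff_smul_absEmbedding ℚ K _).mpr fun x ↦ ?_
      rw [absoluteGaloisGroup.toAlgEquiv_symm_apply]
      exact (IntermediateField.mem_fixingSubgroup_iff F σ).mp hσ _ (by rw [hFdef]; exact ⟨x, rfl⟩)
    have h := hfix _ hσ'
    rwa [absoluteGaloisGroup.toAlgEquiv_symm_apply] at h
  obtain ⟨z, hz⟩ : ∃ z : K, absEmbedding ℚ K z = ζ := AlgHom.mem_fieldRange.mp hζF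
  have hz3 : IsPrimitiveRoot z 3 :=
    IsPrimitiveRoot.of_map_of_injective (f := absEmbedding ℚ K) (by rw [hz]; exact hζ)
      (absEmbedding ℚ K).toRingHom.injective
  -- `K = ℚ(z)` is the third cyclotomic field
  haveI : NeZero (3 : ℕ) := ⟨by norm_num⟩
  haveI hL : IsCyclotomicExtension {3} ℚ ℚ⟮z⟯ :=
    IsPrimitiveRoot.intermediateField_adjoin_isCyclotomicExtension (K := ℚ) hz3
  have hfin : Module.finrank ℚ ℚ⟮z⟯ = 2 := by
    rw [IsCyclotomicExtension.finrank (K := ℚ) (n := 3) ℚ⟮z⟯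
      (Polynomial.cyclotomic.irreducible_rat (by norm_num))]
    decide
  have htop : ℚ⟮z⟯ = ⊤ :=
    IntermediateField.eq_of_le_of_finrank_eq le_top (by rw [hfin, IntermediateField.finrank_top', h2])
  haveI : IsCyclotomicExtension {3} ℚ K :=
    IsCyclotomicExtension.equiv {3} ℚ ℚ⟮z⟯
      ((IntermediateField.equivOfEq htop).trans IntermediateField.topEquiv)
  have h := IsCyclotomicExtension.Rat.discr_prime (K := K) (p := 3)
  norm_num at h
  exact h

end Cyclotomic

/-! ### §8 Assembly -/

section Assembly

variable (W : WeierstrassCurve ℚ) [W.IsElliptic] (K : Type) [Field K] [NumberField K]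
  (p : ℕ) [Fact p.Prime]

/-- **Prop. 5.26 (3) on a global minimal model.** For `E/ℚ` in global minimal form, `K`
quadratic with `(N_E, d_K) = 1`, `p ≠ 2`, `E_K[p]` irreducible and some framing of `E_K[p]` not
absolutely irreducible: `p = 3` and `d_K = −3`. With `H = res(Γ_K)` (open, index `2`): `ρ̄(H)`
is commutative and no line is `H`-stable (§2), `ker ρ̄ ≤ H` (§3), so `H` contains every inertia
group away from `p` (§3 of the sibling + Néron–Ogg–Shafarevich), hence `p ∤ N_E` and some
inertia group above `p` is not inside `H` (Minkowski, sibling §0); supersingular `p` is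
impossible (§4), ordinary `p ≥ 5` is impossible (§5), and for ordinary `p = 3`, `H = ker χ̄₃`
(§6), so `d_K = −3` (§7).
[cite: MatarNekovar2019, Prop. 5.26 (3) (p. 492) and its proof (p. 493)]
[cite: Serre1972, §1.11 Prop. 11–12; §4.2 Lemme 2] -/
theorem eq_three_and_discr_eq_neg_three_of_isGloballyMinimal [W.IsGloballyMinimal]
    (h2 : Module.finrank ℚ K = 2)
    (hcop : Nat.Coprime (W.conductorNorm ℤ) (NumberField.discr K).natAbs) (hp2 : p ≠ 2)
    (hirrK : (W.baseChange K).HasIrreducibleModPGaloisRep p)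
    {ρ : ModPGaloisRep K (ZMod p) 2} (hρ : (W.baseChange K).IsTorsionGaloisRep p ρ)
    (habs : ¬ FramedRep.IsAbsolutelyIrreducible ρ) :
    p = 3 ∧ NumberField.discr K = -3 := by
  have hp : p.Prime := Fact.out
  obtain ⟨hopen, hind⟩ := Automorphic.isOpen_range_absGaloisRestrict_and_index ℚ K
  set H : Subgroup (absoluteGaloisGroup ℚ) := (absGaloisRestrict ℚ K).range with hHdef
  have hH2 : H.index = 2 := hind.trans h2
  have hcomm : ∀ σ₁ ∈ H, ∀ σ₂ ∈ H, ∀ P : geomTorsion W (p : ℤ), σ₁ • σ₂ • P = σ₂ • σ₁ • P :=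
    fun σ₁ h₁ σ₂ h₂ P ↦ smul_comm_of_mem_range W K p hirrK hρ habs h₁ h₂ P
  have hnoline : ∀ Φ : AddSubgroup (geomTorsion W (p : ℤ)), Nat.card Φ = p →
      (∀ σ ∈ H, ∀ P ∈ Φ, σ • P ∈ Φ) → False := by
    intro Φ hΦ hstab
    refine false_of_stable_of_hasIrreducibleModPGaloisRep_baseChange W K p hirrK ?_
      (ne_top_of_card_eq hΦ) hstab
    intro h
    rw [h, AddSubgroup.card_bot] at hΦ
    exact hp.one_lt.ne hΦ
  have hker : ∀ σ₀ : absoluteGaloisGroup ℚ, (∀ P : geomTorsion W (p : ℤ), σ₀ • P = P) → σ₀ ∈ H :=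
    fun σ₀ hσ₀ ↦ mem_of_forall_smul_eq hH2 hcomm hnoline hp2 hσ₀
  -- inertia at a place `v` lies in `H` unless `q_v = p` is a prime of good reduction
  have haway : ∀ (𝔔 : Ideal (absIntegers (𝓞 ℚ) ℚ)) (v : HeightOneSpectrum (𝓞 ℚ)),
      𝔔 ∈ v.primesAbove → ((primesEquiv v : ℕ) ≠ p ∨ (primesEquiv v : ℕ) ∣ W.conductorNorm ℤ) →
      𝔔.inertia (absoluteGaloisGroup ℚ) ≤ H := by
    intro 𝔔 v h𝔔 hv
    haveI : Fact (Nat.Prime (primesEquiv v : ℕ)) := ⟨(primesEquiv v).2⟩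
    by_cases hN : (primesEquiv v : ℕ) ∣ W.conductorNorm ℤ
    · exact inertia_le_range_of_dvd_conductorNorm W K h2 hcop hN h𝔔
    have hgood : W.HasGoodReductionAtPrime (primesEquiv v : ℕ) := by
      by_contra h
      exact hN ((W.dvd_conductorNorm_iff_not_hasGoodReductionAtPrime _).mpr h)
    intro τ hτ
    refine hker τ fun P ↦ ?_
    have h1 := W.galoisRepTorsion_eq_one_of_mem_inertia_prime p (hv.resolve_right hN) hgood rfl h𝔔 hτ
    exact (galoisRepTorsion_eq_one_iff' W (p : ℤ) τ).mp h1 P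
  -- `p ∤ N_E` (else `H` would be unramified everywhere)
  have hNp : ¬ p ∣ W.conductorNorm ℤ := by
    intro hNp
    refine not_forall_inertia_le_of_index_two H hopen hH2 fun 𝔓 h𝔓max ↦ ?_
    obtain ⟨v, h𝔓⟩ := exists_mem_primesAbove_of_isMaximal 𝔓
    refine haway 𝔓 v h𝔓 ?_
    by_cases hvp : (primesEquiv v : ℕ) = p
    · right; rwa [hvp]
    · left; exact hvp
  have hgood : W.HasGoodReductionAtPrime p := by
    by_contra h
    exact hNp ((W.dvd_conductorNorm_iff_not_hasGoodReductionAtPrime _).mpr h)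
  -- some inertia group above `p` is not inside `H`
  set vp : HeightOneSpectrum (𝓞 ℚ) := primesEquiv.symm ⟨p, hp⟩ with hvpdef
  have hvp : (primesEquiv vp : ℕ) = p := by rw [hvpdef, Equiv.apply_symm_apply]
  obtain ⟨𝔓, h𝔓, hI⟩ : ∃ 𝔓 ∈ vp.primesAbove, ¬ 𝔓.inertia (absoluteGaloisGroup ℚ) ≤ H := by
    by_contra! hall
    refine not_forall_inertia_le_of_index_two H hopen hH2 fun 𝔓 h𝔓max ↦ ?_
    obtain ⟨v, h𝔓⟩ := exists_mem_primesAbove_of_isMaximal 𝔓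
    by_cases hv : (primesEquiv v : ℕ) = p
    · have hvv : v = vp := primesEquiv.injective (Subtype.ext (hv.trans hvp.symm))
      rw [hvv] at h𝔓
      exact hall 𝔓 h𝔓
    · exact haway 𝔓 v h𝔓 (Or.inl hv)
  -- supersingular `p` is impossible
  have hord : ¬ (p : ℤ) ∣ W.frobeniusTrace p := fun hss ↦
    false_of_supersingular_of_not_le hH2 hcomm hp2 hgood hss hvp h𝔓 hI
  by_cases hp3 : p = 3
  · subst hp3
    refine ⟨rfl, ?_⟩
    have hHV := mem_iff_modPCyclotomicCharacter_eq_one_of_ordinary_three hH2 hcomm hnoline hker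
      hopen hgood hord (fun 𝔔 v h𝔔 hv ↦ haway 𝔔 v h𝔔 (Or.inl hv))
    exact discr_eq_neg_three_of_forall_mem_range_iff K h2 hHV
  · exact absurd (false_of_ordinary_of_five_le hcomm hnoline hH2
      (hp.five_le_of_ne_two_of_ne_three hp2 hp3) hgood hord hvp h𝔓) not_false

omit [W.IsElliptic] [Fact p.Prime] in
/-- Base change commutes with a change of Weierstrass equation: `(C • W)_K = C_K • W_K`.
[folklore] -/
private theorem baseChange_smul_eq (C : VariableChange ℚ) :
    (C • W).baseChange K = (C.map (algebraMap ℚ K)) • (W.baseChange K) := by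
  rw [baseChange, baseChange, map_variableChange]

/-- **A framing of `E[n]` is a framing of `E'[n]` for an isomorphic equation `E' = C • E`**
(the coordinate change `E(F̄) ≃ E'(F̄)` is `Γ_F`-equivariant,
`VariableChange.pointEquivBaseChange_map_algEquiv`): the representation `ρ̄_{E,p}` depends only on
the isomorphism class of `E` (Silverman, *AEC* III.§7; Cornell–Silverman–Stevens Ch. II §7).
[cite: SilvermanCSS1997, §7] [cite: SilvermanAEC2009, III.§7] -/
theorem isTorsionGaloisRep_smul {F : Type u} [Field F] (X : WeierstrassCurve F) (C : VariableChange F)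
    {n : ℕ} [Fact n.Prime] {ρ : ModPGaloisRep F (ZMod n) 2} (hρ : X.IsTorsionGaloisRep n ρ) :
    (C • X).IsTorsionGaloisRep n ρ := by
  obtain ⟨e₀, he₀⟩ := hρ
  let e : geomPoints X ≃+ geomPoints (C • X) :=
    VariableChange.pointEquivBaseChange X C (AlgebraicClosure F)
  have hsmul : ∀ (σ : absoluteGaloisGroup F) (P : geomPoints X), e (σ • P) = σ • e P := fun σ P ↦
    VariableChange.pointEquivBaseChange_map_algEquiv X C (absoluteGaloisGroup.toAlgEquiv F σ) P
  have htor : ∀ {P : geomPoints X}, P ∈ geomTorsion X n ↔ e P ∈ geomTorsion (C • X) n := by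
    intro P
    rw [geomTorsion, geomTorsion, AddSubgroup.torsionBy.nsmul_iff, AddSubgroup.torsionBy.nsmul_iff,
      ← map_nsmul, AddEquiv.map_eq_zero_iff]
  let eₙ : geomTorsion X n ≃+ geomTorsion (C • X) n :=
    { toFun := fun P ↦ ⟨e P, htor.mp P.2⟩
      invFun := fun Q ↦ ⟨e.symm Q, by rw [htor, e.apply_symm_apply]; exact Q.2⟩
      left_inv := fun P ↦ Subtype.ext (e.symm_apply_apply _)
      right_inv := fun Q ↦ Subtype.ext (e.apply_symm_apply _)
      map_add' := fun P Q ↦ Subtype.ext (by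
        change e ((P : geomPoints X) + Q) = e P + e Q
        exact map_add e _ _) }
  have heₙ : ∀ (σ : absoluteGaloisGroup F) (P : geomTorsion X n), eₙ (σ • P) = σ • eₙ P :=
    fun σ P ↦ Subtype.ext (by
      change e ((σ • P : geomTorsion X n) : geomPoints X) = _
      rw [AddSubgroup.torsionBy.coe_smul, hsmul]
      rfl)
  have heₙ' : ∀ (σ : absoluteGaloisGroup F) (Q : geomTorsion (C • X) n),
      eₙ.symm (σ • Q) = σ • eₙ.symm Q := by
    intro σ Q
    apply eₙ.injective
    rw [heₙ, eₙ.apply_symm_apply, eₙ.apply_symm_apply]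
  refine ⟨eₙ.symm.trans e₀, fun σ Q ↦ ?_⟩
  rw [AddEquiv.trans_apply, AddEquiv.trans_apply, heₙ', he₀]

/-- **Matar–Nekovář Prop. 5.26 (3), as a theorem** (reduction to a global minimal model:
irreducibility, framings and `N_E` are invariant under a change of Weierstrass equation).
[cite: MatarNekovar2019, Prop. 5.26 (3) (p. 492)] -/
theorem eq_three_and_discr_eq_neg_three (h2 : Module.finrank ℚ K = 2)
    (hcop : Nat.Coprime (W.conductorNorm ℤ) (NumberField.discr K).natAbs) (hp2 : p ≠ 2)
    (hirrK : (W.baseChange K).HasIrreducibleModPGaloisRep p)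
    {ρ : ModPGaloisRep K (ZMod p) 2} (hρ : (W.baseChange K).IsTorsionGaloisRep p ρ)
    (habs : ¬ FramedRep.IsAbsolutelyIrreducible ρ) :
    p = 3 ∧ NumberField.discr K = -3 := by
  obtain ⟨C, hC⟩ := hasGlobalMinimalModel_rat_holds W
  haveI := hC
  have hirrK' : ((C • W).baseChange K).HasIrreducibleModPGaloisRep p := by
    rw [baseChange_smul_eq, Mazur1978.hasIrreducibleModPGaloisRep_smul_iff]
    exact hirrK
  have hcop' : Nat.Coprime ((C • W).conductorNorm ℤ) (NumberField.discr K).natAbs := by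
    rwa [conductorNorm_smul ℤ W C]
  have hρ' : ((C • W).baseChange K).IsTorsionGaloisRep p ρ := by
    rw [baseChange_smul_eq]
    exact isTorsionGaloisRep_smul (W.baseChange K) (C.map (algebraMap ℚ K)) hρ
  exact eq_three_and_discr_eq_neg_three_of_isGloballyMinimal (C • W) K p h2 hcop' hp2 hirrK' hρ' habs

end Assembly

/-- **Discharge of the named fact `prop526_three_of_irreducible_of_not_isAbsolutelyIrreducible`**
(Matar–Nekovář 2019, Prop. 5.26 (3)): for `E/ℚ`, `K` quadratic with `(N_E, d_K) = 1`, `p ≠ 2`,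
`E_K[p]` irreducible and a framing of `E_K[p]` that is not absolutely irreducible, `p = 3` and
`d_K = −3`. [cite: MatarNekovar2019, Prop. 5.26 (3) (p. 492)] -/
theorem prop526_three_of_irreducible_of_not_isAbsolutelyIrreducible_holds :
    prop526_three_of_irreducible_of_not_isAbsolutelyIrreducible := by
  intro W _ K _ _ h2 hcop p _ hp2 hirrK ρ hρ habs
  exact eq_three_and_discr_eq_neg_three W K p h2 hcop hp2 hirrK hρ habs

end Literature.NumberTheory.EllipticCurves.MatarNekovar2019

end
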